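import Mathlib
import Literature.Geometry.DiscreteGeometry.CrystallographicGroups
import Summits.AtomisticToContinuum.Crystallization.Theorems.IsometryAtomsMinimisingLawsCohesiveGroupStructureAux1

/-!
# Sub-goal `groupStructure_card_le_of_invariantLine` of stub `stub_groupStructure` — line `purity_stacking`, crux
# `IsometryAtoms.MinimisingLawsCohesive` (stmt-AtomisticToContinuum-15777)

Helper file (registered sub-goal). Lands at
`Summits/AtomisticToContinuum/Crystallization/Theorems/IsometryAtomsMinimisingLawsCohesiveGroupStructureLineBound.lean`
with `--supports stmt-AtomisticToContinuum-15777`. Auxiliary lemmas go in the sub-namespace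
`…GroupStructure.LineBound`.

## Mathematics

Let `Γ` be a discontinuous group of isometries of `E = ℝ³` leaving the line `V = c + ℝ e`
(`‖e‖ = 1`) invariant. Every `g ∈ Γ` acts on `V` as `c + s • e ↦ c + (ε s + σ) • e` with a sign
`ε = ±1` (the linear part `L g` maps `e` to `± e`) and a shift `σ`. In a FINITE subgroup `H ≤ Γ`
an element with `ε = 1` has `σ = 0` (otherwise its powers move `c` arbitrarily far, contradicting
finite order), so it fixes `c`; and two elements with `ε = -1` differ by one with `ε = 1`. Hence
`H` injects into two copies of the (finite, by discontinuity) stabiliser of `c` in `Γ`, which bounds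
`Nat.card H` by twice the size of that stabiliser, uniformly in `H`.
-/

noncomputable section

open scoped RealInnerProductSpace
open Literature.Geometry.DiscreteGeometry.Crystallographic Module

namespace Summit.AtomisticToContinuum.Crystallization.Theorems.IsometryAtomsMinimisingLawsCohesive.GroupStructure

namespace LineBound

/-! ## Points of the line `c + ℝ e` -/

/-- Membership in the affine line `mk' c (span ℝ {e})`: `x = c + s • e` for some real `s`. -/
theorem mem_line_iff {c e x : EuclideanSpace ℝ (Fin 3)} :
    x ∈ AffineSubspace.mk' c (Submodule.span ℝ {e}) ↔ ∃ s : ℝ, x = c + s • e := by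
  rw [AffineSubspace.mem_mk', vsub_eq_sub, Submodule.mem_span_singleton]
  refine exists_congr fun s => ?_
  rw [eq_sub_iff_add_eq, add_comm, eq_comm]

/-- If `g` maps the line onto itself, the image of a point of the line is `c + s • e`. -/
theorem exists_apply_eq_add_smul {g : EuclideanSpace ℝ (Fin 3) ≃ᵢ EuclideanSpace ℝ (Fin 3)}
    {c e : EuclideanSpace ℝ (Fin 3)}
    (hVg : g '' (AffineSubspace.mk' c (Submodule.span ℝ {e}) : Set (EuclideanSpace ℝ (Fin 3))) =
      AffineSubspace.mk' c (Submodule.span ℝ {e}))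
    {x : EuclideanSpace ℝ (Fin 3)} (hx : x ∈ AffineSubspace.mk' c (Submodule.span ℝ {e})) :
    ∃ s : ℝ, g x = c + s • e := by
  rw [← mem_line_iff]
  have h : g x ∈ g '' (AffineSubspace.mk' c (Submodule.span ℝ {e}) : Set (EuclideanSpace ℝ (Fin 3))) :=
    Set.mem_image_of_mem g hx
  rw [hVg] at h
  exact h

/-- The point `c + s • e` lies on the line. -/
theorem add_smul_mem_line (c e : EuclideanSpace ℝ (Fin 3)) (s : ℝ) :
    c + s • e ∈ AffineSubspace.mk' c (Submodule.span ℝ {e}) :=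
  mem_line_iff.2 ⟨s, rfl⟩

/-! ## The sign `ε = ±1` of an isometry preserving the line -/

/-- If `g` maps the line `c + ℝ e` (`‖e‖ = 1`) onto itself, its linear part sends `e` to `e` or
to `-e`. -/
theorem lin_apply_eq_or_eq_neg {g : EuclideanSpace ℝ (Fin 3) ≃ᵢ EuclideanSpace ℝ (Fin 3)}
    {c e : EuclideanSpace ℝ (Fin 3)} (he : ‖e‖ = 1)
    (hVg : g '' (AffineSubspace.mk' c (Submodule.span ℝ {e}) : Set (EuclideanSpace ℝ (Fin 3))) =
      AffineSubspace.mk' c (Submodule.span ℝ {e})) :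
    g.toRealLinearIsometryEquiv e = e ∨ g.toRealLinearIsometryEquiv e = -e := by
  obtain ⟨σ, hσ⟩ := exists_apply_eq_add_smul hVg (AffineSubspace.self_mem_mk' c _)
  have hce : c + e ∈ AffineSubspace.mk' c (Submodule.span ℝ {e}) := by
    have h := add_smul_mem_line c e 1
    rwa [one_smul] at h
  obtain ⟨τ, hτ⟩ := exists_apply_eq_add_smul hVg hce
  have hL : g.toRealLinearIsometryEquiv e = (τ - σ) • e := by
    have h := apply_sub_apply g (c + e) c
    rw [add_sub_cancel_left, hσ, hτ] at h
    rw [← h, sub_smul]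
    abel
  have habs : |τ - σ| = 1 := by
    have h := g.toRealLinearIsometryEquiv.norm_map e
    rw [hL, norm_smul, Real.norm_eq_abs, he, mul_one] at h
    exact h
  rcases (abs_eq zero_le_one).1 habs with h | h
  · left
    rw [hL, h, one_smul]
  · right
    rw [hL, h, neg_one_smul]

/-- Two isometries whose linear parts both reverse `e` have a quotient whose linear part fixes
`e`. -/
theorem lin_inv_mul_apply_eq {g g' : EuclideanSpace ℝ (Fin 3) ≃ᵢ EuclideanSpace ℝ (Fin 3)}
    {e : EuclideanSpace ℝ (Fin 3)} (h1 : g.toRealLinearIsometryEquiv e = -e)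
    (h2 : g'.toRealLinearIsometryEquiv e = -e) :
    (g⁻¹ * g').toRealLinearIsometryEquiv e = e := by
  rw [lin_mul, lin_inv, LinearIsometryEquiv.coe_mul, Function.comp_apply, h2, map_neg,
    LinearIsometryEquiv.coe_inv]
  have h : g.toRealLinearIsometryEquiv.symm e = -e := by
    apply g.toRealLinearIsometryEquiv.injective
    rw [LinearIsometryEquiv.apply_symm_apply, map_neg, h1, neg_neg]
  rw [h, neg_neg]

/-! ## Elements with `ε = 1`: shifts along the line -/

/-- If `L g e = e` and `g c = c + σ • e`, then `g` shifts the line by `σ`: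
`g (c + t • e) = c + (t + σ) • e`. -/
theorem apply_add_smul_of_lin_apply_eq {g : EuclideanSpace ℝ (Fin 3) ≃ᵢ EuclideanSpace ℝ (Fin 3)}
    {c e : EuclideanSpace ℝ (Fin 3)} (hLe : g.toRealLinearIsometryEquiv e = e) {σ : ℝ}
    (hσ : g c = c + σ • e) (t : ℝ) : g (c + t • e) = c + (t + σ) • e := by
  have h := apply_sub_apply g (c + t • e) c
  rw [add_sub_cancel_left, map_smul, hLe, hσ, sub_eq_iff_eq_add] at h
  rw [h, add_smul]
  abel

/-- Iterating a shift: `(g ^ n) c = c + (n σ) • e`. -/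
theorem pow_apply_eq {g : EuclideanSpace ℝ (Fin 3) ≃ᵢ EuclideanSpace ℝ (Fin 3)}
    {c e : EuclideanSpace ℝ (Fin 3)} (hLe : g.toRealLinearIsometryEquiv e = e) {σ : ℝ}
    (hσ : g c = c + σ • e) (n : ℕ) : (g ^ n) c = c + ((n : ℝ) * σ) • e := by
  induction n with
  | zero => rw [pow_zero, IsometryEquiv.coe_one, id_eq, Nat.cast_zero, zero_mul, zero_smul, add_zero]
  | succ n ih =>
    rw [pow_succ', IsometryEquiv.coe_mul, Function.comp_apply, ih,
      apply_add_smul_of_lin_apply_eq hLe hσ, Nat.cast_succ, add_mul, one_mul]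

/-- **An element of a finite group of isometries that maps the line `c + ℝ e` to itself with
`ε = 1` fixes `c`**: its shift `σ` vanishes since `g ^ n = 1` forces `n σ = 0`. -/
theorem apply_eq_self_of_finite
    {H : Subgroup (EuclideanSpace ℝ (Fin 3) ≃ᵢ EuclideanSpace ℝ (Fin 3))} [Finite H]
    {g : EuclideanSpace ℝ (Fin 3) ≃ᵢ EuclideanSpace ℝ (Fin 3)} (hg : g ∈ H)
    {c e : EuclideanSpace ℝ (Fin 3)} (he : e ≠ 0) (hLe : g.toRealLinearIsometryEquiv e = e)
    (hσ : ∃ σ : ℝ, g c = c + σ • e) : g c = c := by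
  obtain ⟨σ, hσ⟩ := hσ
  have hfo : IsOfFinOrder (⟨g, hg⟩ : H) := isOfFinOrder_of_finite _
  obtain ⟨n, hn, hpow⟩ := hfo.exists_pow_eq_one
  have hpow' : g ^ n = 1 := by
    have h := congrArg (fun x : H => (x : EuclideanSpace ℝ (Fin 3) ≃ᵢ EuclideanSpace ℝ (Fin 3))) hpow
    simpa using h
  have h := pow_apply_eq hLe hσ n
  rw [hpow', IsometryEquiv.coe_one, id_eq] at h
  rcases smul_eq_zero.1 (left_eq_add.1 h) with h3 | h3
  · rcases mul_eq_zero.1 h3 with h4 | h4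
    · exact absurd h4 (Nat.cast_ne_zero.2 hn.ne')
    · rw [hσ, h4, zero_smul, add_zero]
  · exact absurd h3 he

end LineBound

open LineBound in
/-- **Sub-goal `groupStructure_card_le_of_invariantLine`**: a discontinuous group `Γ` of
isometries of `ℝ³` leaving a line `c + ℝ e` (`‖e‖ = 1`) invariant has finite subgroups of
bounded order. Proof: the stabiliser `S = {g ∈ Γ | g c = c}` is finite by discontinuity; in a
finite subgroup `H ≤ Γ` every element whose linear part fixes `e` fixes `c`
(`LineBound.apply_eq_self_of_finite`), and if `h₁ ∈ H` does not fix `c` then `h₁⁻¹ h` does for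
every other such `h`; so `H` injects into `S ⊕ S` and `Nat.card H ≤ 2 |S|`. -/
theorem groupStructure_card_le_of_invariantLine : ∀ Γ : Subgroup (EuclideanSpace ℝ (Fin 3) ≃ᵢ EuclideanSpace ℝ (Fin 3)), Literature.Geometry.DiscreteGeometry.Crystallographic.IsDiscontinuous Γ → ∀ c e : EuclideanSpace ℝ (Fin 3), ‖e‖ = 1 → (∀ g ∈ Γ, g '' (AffineSubspace.mk' c (Submodule.span ℝ {e}) : Set (EuclideanSpace ℝ (Fin 3))) = AffineSubspace.mk' c (Submodule.span ℝ {e})) → ∃ N : ℕ, ∀ H : Subgroup (EuclideanSpace ℝ (Fin 3) ≃ᵢ EuclideanSpace ℝ (Fin 3)), H ≤ Γ → Finite H → Nat.card H ≤ N := by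
  intro Γ hΓ c e he hV
  have he0 : e ≠ 0 := by
    intro h0
    rw [h0, norm_zero] at he
    exact zero_ne_one he
  -- the stabiliser of `c` in `Γ`, finite by discontinuity
  set S : Set (EuclideanSpace ℝ (Fin 3) ≃ᵢ EuclideanSpace ℝ (Fin 3)) :=
    {g | g ∈ Γ ∧ g c = c} with hS
  have hSfin : S.Finite := finite_setOf_apply_eq hΓ c
  haveI : Finite S := hSfin.to_subtype
  refine ⟨2 * Nat.card S, fun H hH hHf => ?_⟩
  haveI : Finite H := hHf
  classical
  -- every element of `H` whose linear part fixes `e` fixes `c`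
  have hfix : ∀ h ∈ H, h.toRealLinearIsometryEquiv e = e → h c = c := fun h hh hLe =>
    apply_eq_self_of_finite hh he0 hLe
      (exists_apply_eq_add_smul (hV h (hH hh)) (AffineSubspace.self_mem_mk' c _))
  -- an element of `H` not fixing `c` has `ε = -1`
  have hneg : ∀ h ∈ H, h c ≠ c → h.toRealLinearIsometryEquiv e = -e := fun h hh hc =>
    (lin_apply_eq_or_eq_neg he (hV h (hH hh))).resolve_left fun hLe => hc (hfix h hh hLe)
  by_cases hall : ∀ h ∈ H, h c = c
  · -- `H ⊆ S`
    have hinj : Function.Injective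
        (fun h : H => (⟨(h : EuclideanSpace ℝ (Fin 3) ≃ᵢ EuclideanSpace ℝ (Fin 3)),
          ⟨hH h.2, hall _ h.2⟩⟩ : S)) := by
      intro a b hab
      have hab' := Subtype.ext_iff.1 hab
      exact Subtype.ext hab'
    calc Nat.card H ≤ Nat.card S := Nat.card_le_card_of_injective _ hinj
      _ ≤ 2 * Nat.card S := Nat.le_mul_of_pos_left _ two_pos
  · push Not at hall
    obtain ⟨h₁, hh₁, hc₁⟩ := hall
    have hε₁ : h₁.toRealLinearIsometryEquiv e = -e := hneg h₁ hh₁ hc₁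
    -- elements fixing `c` go to the first copy of `S`, the others (times `h₁⁻¹`) to the second
    have hinl : Function.Injective
        (fun a : {h : H // (h : EuclideanSpace ℝ (Fin 3) ≃ᵢ EuclideanSpace ℝ (Fin 3)) c = c} =>
          (⟨(a.1 : EuclideanSpace ℝ (Fin 3) ≃ᵢ EuclideanSpace ℝ (Fin 3)), ⟨hH a.1.2, a.2⟩⟩ : S)) := by
      intro a b hab
      have hab' := Subtype.ext_iff.1 hab
      exact Subtype.ext (Subtype.ext hab')
    have hmemS : ∀ a : {h : H // ¬ (h : EuclideanSpace ℝ (Fin 3) ≃ᵢ EuclideanSpace ℝ (Fin 3)) c = c},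
        h₁⁻¹ * (a.1 : EuclideanSpace ℝ (Fin 3) ≃ᵢ EuclideanSpace ℝ (Fin 3)) ∈ S := fun a =>
      ⟨Γ.mul_mem (Γ.inv_mem (hH hh₁)) (hH a.1.2),
        hfix _ (H.mul_mem (H.inv_mem hh₁) a.1.2)
          (lin_inv_mul_apply_eq hε₁ (hneg _ a.1.2 a.2))⟩
    have hinr : Function.Injective
        (fun a : {h : H // ¬ (h : EuclideanSpace ℝ (Fin 3) ≃ᵢ EuclideanSpace ℝ (Fin 3)) c = c} =>
          (⟨h₁⁻¹ * (a.1 : EuclideanSpace ℝ (Fin 3) ≃ᵢ EuclideanSpace ℝ (Fin 3)), hmemS a⟩ : S)) := by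
      intro a b hab
      have hab' := Subtype.ext_iff.1 hab
      exact Subtype.ext (Subtype.ext (mul_left_cancel hab'))
    have hinj := (Function.Injective.sumMap hinl hinr).comp
      (Equiv.sumCompl fun h : H =>
        (h : EuclideanSpace ℝ (Fin 3) ≃ᵢ EuclideanSpace ℝ (Fin 3)) c = c).symm.injective
    calc Nat.card H ≤ Nat.card (S ⊕ S) := Nat.card_le_card_of_injective _ hinj
      _ = 2 * Nat.card S := by rw [Nat.card_sum, two_mul]

end Summit.AtomisticToContinuum.Crystallization.Theorems.IsometryAtomsMinimisingLawsCohesive.GroupStructure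

end
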